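import Literature.NumberTheory.GaloisCohomology.ShaRestrictedLayerDescent
import Literature.NumberTheory.EllipticCurves.SubgroupH1ClosedSubgroupColimit
import Literature.NumberTheory.EllipticCurves.GreenbergVatsal2000.GreenbergSelmerGroups
import Literature.NumberTheory.GaloisRepresentations.DecompositionGroupOfCompletion
import Literature.NumberTheory.GaloisRepresentations.IntegralGaloisActionProofs
import HarnessLib

/-!
# Exhaustion of the unramified classes over `K̄^H` (`H = ⋂ₙ Uₙ` closed) by layer cocycles vanishing on `N_S`

Topic `Literature/NumberTheory/GaloisCohomology` (namespace `Literature.NumberTheory.GaloisCohomology.ShaLayer`, sequel of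
`ShaRestrictedLayerDescent` and `EllipticCurves/SubgroupH1ClosedSubgroupColimit`).  THEOREMS ONLY (no definition, no named
fact, no instance, no `sorry`).

* §1 `apply_eq_zero_of_mem_unramifiedOutside` — a cocycle of a NORMAL `H ≥ I_𝔓` representing a class of Greenberg–Vatsal's
  `unramifiedOutside H M p S₀` VANISHES on every inertia group `I_𝔓`, `𝔓 ∣ v ∉ S₀`, `v ∤ p`, which acts trivially on `M`
  (transport to the chosen prime `𝔓₀ = adicCompletionPrime K v` by `g` with `g • 𝔓₀ = 𝔓`; the condition for `conj_{g⁻¹}` is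
  principality on `H ⊓ I_{𝔓₀}`, i.e. vanishing, since `I_{𝔓₀}` acts trivially);
* §2 `exists_cocycle_layer_of_mem_unramifiedOutside` — for `H ≤ Uₙ` closed, `(Uₙ)` open and cofinal among the open
  neighbourhoods of `H`, `N_S ≤ H`, `N_S` acting trivially on `M`, and `S ⊇ S₀ ∪ {v ∣ p}`: every class of
  `unramifiedOutside H M p S₀` is the restriction of the class of a cocycle of some `Uₙ` which VANISHES ON `N_S`
  (Serre I §2.2 Prop. 8 surjectivity + §1 + `forall_ramificationSubgroup_eq_zero_of_forall_inertia`).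

Written for cell `bsd-print-cf2` (seat cf2c-w8 g8, plug (π3) of ROW 1).  HONEST FRAMING: Galois-cohomological bookkeeping only.

## References
* J.-P. Serre, *Galois Cohomology* (1997), I §2.2 Prop. 8, I §2.6. [SerreGaloisCohomology1997]
* J. Neukirch, A. Schmidt, K. Wingberg (2008), (1.6.7), VIII §3. [NeukirchSchmidtWingberg2008]
* R. Greenberg, V. Vatsal, *On the Iwasawa invariants of elliptic curves* (2000), §2 pp. 16–17. [GreenbergVatsal2000]
* J. Neukirch, *Algebraic Number Theory* (1999), II §9 (9.6). [NeukirchANT1999]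
-/

noncomputable section

open Function Field IsDedekindDomain CategoryTheory
open scoped NumberField Pointwise
open Literature.NumberTheory.GaloisRepresentations
open Literature.NumberTheory.GaloisRepresentations.DiscreteGaloisModule
open Literature.NumberTheory.EllipticCurves
open Literature.NumberTheory.EllipticCurves.GreenbergSelmer
open Literature.NumberTheory.EllipticCurves.GreenbergVatsal2000

namespace Literature.NumberTheory.GaloisCohomology.ShaLayer

variable {K : Type} [Field K] [NumberField K]
variable {M : Type} [AddCommGroup M] [DistribMulAction (absoluteGaloisGroup K) M] [TopologicalSpace M]
  [DiscreteTopology M]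

/-! ## §1 Unramified classes vanish on the inertia groups acting trivially -/

/-- Cocycle criterion for `unramifiedKer`: the class of `f` is unramified at the chosen place above `v` iff `f` is principal on
`H ⊓ I_v`. [cite: GreenbergVatsal2000, §2 p. 17] -/
theorem oneCocycleClass_mem_unramifiedKer_iff (H : Subgroup (absoluteGaloisGroup K)) (v : HeightOneSpectrum (𝓞 K))
    (f : contOneCocycles (discreteTopRep (↥H) M)) :
    oneCocycleClass (discreteTopRep (↥H) M) f ∈ unramifiedKer H M v ↔
      ∃ m : M, ∀ x : inertiaIn H v, f.1 (inertiaInToH H v x) = x • m - m := by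
  rw [GreenbergVatsal2000.unramifiedKer, AddMonoidHom.mem_ker, CocycleCriteria.resH1Hom_oneCocycleClass_eq_zero_iff]
  rfl

/-- **An unramified class vanishes on every inertia group acting trivially.** Let `H ⊴ Γ_K`, `v ∉ S₀` with `v ∤ p`,
`𝔓 ∣ v` a prime of `ℤ̄_K` with `I_𝔓 ≤ H` and `I_𝔓` acting trivially on `M`; if the class of the cocycle `f` of `H` lies in
`unramifiedOutside H M p S₀` then `f` vanishes on `I_𝔓`. [cite: GreenbergVatsal2000, §2 pp. 16–17] [cite: NeukirchANT1999, II §9 (9.6)] -/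
theorem apply_eq_zero_of_mem_unramifiedOutside (H : Subgroup (absoluteGaloisGroup K)) [H.Normal] (p : ℕ)
    (S₀ : Set (HeightOneSpectrum (𝓞 K))) (f : contOneCocycles (discreteTopRep (↥H) M))
    (hf : oneCocycleClass (discreteTopRep (↥H) M) f ∈ unramifiedOutside H M p S₀)
    {v : HeightOneSpectrum (𝓞 K)} (hv : v ∉ S₀) (hpv : ((p : ℕ) : 𝓞 K) ∉ v.asIdeal)
    {𝔓 : Ideal (absIntegers (𝓞 K) K)} (h𝔓 : 𝔓 ∈ v.primesAbove)
    (hIH : 𝔓.inertia (absoluteGaloisGroup K) ≤ H)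
    (hIM : ∀ σ ∈ 𝔓.inertia (absoluteGaloisGroup K), ∀ m : M, σ • m = m)
    (τ : absoluteGaloisGroup K) (hτ : τ ∈ 𝔓.inertia (absoluteGaloisGroup K)) :
    f.1 ⟨τ, hIH hτ⟩ = 0 := by
  -- `g • 𝔓 = 𝔓₀` for the chosen prime `𝔓₀`, whose inertia group is `inertia v`
  obtain ⟨g, hg⟩ := HeightOneSpectrum.exists_smul_eq_of_mem_primesAbove_holds h𝔓 (adicCompletionPrime_mem_primesAbove K v)
  have hI₀ : GreenbergSelmer.inertia v = (adicCompletionPrime K v).inertia (absoluteGaloisGroup K) :=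
    (inertia_adicCompletionPrime_eq_map_absInertia K v).symm
  -- `σ₀ = g τ g⁻¹ ∈ I_{𝔓₀} ∩ H ∩ D_v`
  have hσ₀I : g * τ * g⁻¹ ∈ (adicCompletionPrime K v).inertia (absoluteGaloisGroup K) := by
    have h := conj_mem_inertia_smul hτ g
    rw [hg] at h
    exact h
  have hσ₀H : g * τ * g⁻¹ ∈ H := (inferInstance : H.Normal).conj_mem τ (hIH hτ) g
  have hσ₀D : g * τ * g⁻¹ ∈ decomp (K := K) v := inertia_le_decomp v (hI₀ ▸ hσ₀I)
  -- the unramified condition for `conj_g [f]` at the chosen place: on cocycles `x ↦ g • f (g⁻¹ x g)`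
  have hc : ∀ (x : H) (m : M), DistribSMul.toAddMonoidHom M g (subgroupConj H g x • m) =
      x • DistribSMul.toAddMonoidHom M g m := fun x m => by
    simp only [DistribSMul.toAddMonoidHom_apply, Subgroup.smul_def, subgroupConj_apply_coe, smul_smul, mul_assoc,
      mul_inv_cancel_left]
  have hconj : conjH1 H M g (oneCocycleClass _ f) = oneCocycleClass _
      (contOneCocycles.pullback (subgroupConj H g)
        (resHomOfEquivariant (subgroupConj H g) (DistribSMul.toAddMonoidHom M g) hc) f) :=
    map_oneCocycleClass _ _ _ f
  have hunr := (mem_unramifiedOutside_iff _).mp hf v hv hpv g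
  rw [hconj, oneCocycleClass_mem_unramifiedKer_iff] at hunr
  obtain ⟨m, hm⟩ := hunr
  -- evaluate at `x = σ₀`: `g • f (g⁻¹ σ₀ g) = σ₀ • m - m = 0` (`σ₀` acts trivially since `τ` does)
  let x : inertiaIn H v := ⟨⟨g * τ * g⁻¹, hσ₀D⟩, (mem_inertiaIn_iff H v _).mpr ⟨hσ₀H, hI₀ ▸ hσ₀I⟩⟩
  have hx : (contOneCocycles.pullback (subgroupConj H g)
      (resHomOfEquivariant (subgroupConj H g) (DistribSMul.toAddMonoidHom M g) hc) f).1 (inertiaInToH H v x) =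
      (g * τ * g⁻¹) • m - m := hm x
  have htriv : (g * τ * g⁻¹) • m - m = 0 := by
    rw [sub_eq_zero, mul_smul, mul_smul, hIM τ hτ (g⁻¹ • m), smul_inv_smul]
  have hval : (contOneCocycles.pullback (subgroupConj H g)
      (resHomOfEquivariant (subgroupConj H g) (DistribSMul.toAddMonoidHom M g) hc) f).1 (inertiaInToH H v x) =
      g • f.1 ⟨τ, hIH hτ⟩ := by
    rw [contOneCocycles.pullback_apply]
    change g • f.1 (subgroupConj H g (inertiaInToH H v x)) = _
    congr 2
    apply Subtype.ext
    simp only [subgroupConj_apply_coe]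
    change g⁻¹ * (g * τ * g⁻¹) * g = τ
    group
  rw [hval, htriv] at hx
  have h2 := congrArg (fun n : M => g⁻¹ • n) hx
  simpa using h2

/-! ## §2 Layer cocycles vanishing on `N_S` -/

/-- **Every unramified class over `K̄^H` is the restriction of a layer cocycle vanishing on `N_S`.** Let `Γ_K ⊇ Uₙ ⊇ H ⊇ N_S`
with `H` closed and normal, every `Uₙ` open, `(Uₙ)` cofinal among the open neighbourhoods of `H`; let `M` be a discrete
`Γ_K`-module with open stabilizers on which `N_S` acts trivially, and `S ⊇ S₀ ∪ {v ∣ p}`.  Then every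
`s ∈ unramifiedOutside H M p S₀` is `res^{Uₙ}_H [c]` for some `n` and some continuous cocycle `c` of `Uₙ` VANISHING ON `N_S`.
[cite: SerreGaloisCohomology1997, I §2.2 Prop. 8] [cite: NeukirchSchmidtWingberg2008, (1.6.7)] [cite: GreenbergVatsal2000, §2 pp. 16–17] -/
theorem exists_cocycle_layer_of_mem_unramifiedOutside (S S₀ : Set (HeightOneSpectrum (𝓞 K))) (p : ℕ)
    (hS₀ : S₀ ⊆ S) (hSp : ∀ v : HeightOneSpectrum (𝓞 K), ((p : ℕ) : 𝓞 K) ∈ v.asIdeal → v ∈ S)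
    (hstab : ∀ m : M, IsOpen (MulAction.stabilizer (absoluteGaloisGroup K) m : Set (absoluteGaloisGroup K)))
    (hMN : ∀ σ ∈ ramificationSubgroup K S, ∀ m : M, σ • m = m)
    (H : Subgroup (absoluteGaloisGroup K)) [H.Normal] (hHc : IsClosed (H : Set (absoluteGaloisGroup K)))
    (hHS : ramificationSubgroup K S ≤ H)
    (U : ℕ → Subgroup (absoluteGaloisGroup K)) (hU : ∀ n, IsOpen (U n : Set (absoluteGaloisGroup K)))
    (hle : ∀ n, H ≤ U n)
    (hcof : ∀ V : Set (absoluteGaloisGroup K), IsOpen V → (H : Set (absoluteGaloisGroup K)) ⊆ V → ∃ n, (U n : Set _) ⊆ V)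
    (s : subgroupH1 H M) (hs : s ∈ unramifiedOutside H M p S₀) :
    ∃ (n : ℕ) (c : contOneCocycles (discreteTopRep (↥(U n)) M)),
      resOfLe M (hle n) (oneCocycleClass _ c) = s ∧
        ∀ (σ : absoluteGaloisGroup K) (hσ : σ ∈ ramificationSubgroup K S), c.1 ⟨σ, (hHS.trans (hle n)) hσ⟩ = 0 := by
  obtain ⟨n, y, hy⟩ := SubgroupH1Colimit.exists_mem_range_resOfLe hstab hHc U hle hcof s
  obtain ⟨c, rfl⟩ := oneCocycleClass_surjective _ y
  refine ⟨n, c, hy, ?_⟩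
  -- the restriction of `c` to `H` represents `s`: `c|_H = f + δa` for a cocycle `f` of `H` with `[f] = s`
  refine forall_ramificationSubgroup_eq_zero_of_forall_inertia S ((U n).isClosed_of_isOpen (hU n)) (hHS.trans (hle n)) c
    fun v hv 𝔓 h𝔓 τ hτ => ?_
  have hpv : ((p : ℕ) : 𝓞 K) ∉ v.asIdeal := fun h => hv (hSp v h)
  have hv₀ : v ∉ S₀ := fun h => hv (hS₀ h)
  have hIN : 𝔓.inertia (absoluteGaloisGroup K) ≤ ramificationSubgroup K S := inertia_le_ramificationSubgroup hv h𝔓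
  -- the restricted cocycle
  set f : contOneCocycles (discreteTopRep (↥H) M) := contOneCocycles.pullback (subgroupInclusion (hle n))
    (resHomOfEquivariant (subgroupInclusion (hle n)) (AddMonoidHom.id M) (fun _ _ ↦ rfl)) c with hf
  have hfs : oneCocycleClass _ f = s := by
    rw [← hy]
    exact (map_oneCocycleClass _ _ _ c).symm
  have h0 := apply_eq_zero_of_mem_unramifiedOutside H p S₀ f (hfs ▸ hs) hv₀ hpv h𝔓 (hIN.trans hHS)
    (fun σ hσ m => hMN σ (hIN hσ) m) τ hτ
  exact h0

end Literature.NumberTheory.GaloisCohomology.ShaLayer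

end
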